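import Literature.Probability.FitznerVanDerHofstad2017.NobleBlocksNT
import HarnessLib

/-!
# The middle block `B^{ι,a,b}` of [FvdH17] (5.4) POINTWISE in its internal pair

R. Fitzner and R. van der Hofstad, *Mean-field behavior for nearest-neighbor percolation in `d > 10`*,
Electron. J. Probab. **22** (2017) no. 43; arXiv:1506.07977v2 — §5.1 (5.4) (p. 48): "`B^{ι,a,b}(0,v,x,y) =
Σ_{u,w} Σ_{c=0}^{2} A^{ι,a,c,*}(0,v,u,w) A^{c,b}(u,w,x,y) + Σ_u A^{ι,a,b}(0,v,x,u) P^{0}(y−u,y−u) + B^{(2),ι}(0,v,x,y)`",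
and App. B Table "Diagrams and definition of `B^{(2),ι,a,b}(0,v,x,y)`" (p. 76, TeX l.10515–10539), whose entries
are themselves sums `Σ_{u,w}` over two internal vertices.  §6.2.1 (pp. 65–67): "The first step is to prove a
pointwise bound on the coefficients. In order to do this, we combine the building blocks to construct the bounding
diagrams." — the `x`-space bound (6.51) is assembled from POINTWISE pieces and the internal vertices are summed
afterwards (the typed regrouping `BlockSummation.le_recP_chain_of_pointwise` / `nobleXiT_le_recP_chain_of_cls` of
`NobleBoundsNClasses` takes exactly such a pointwise middle piece `Bpt κ a a' u w t z w' u'` together with the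
block-summation hypothesis `hBpt : Σ_{t,z} Bpt κ a a' u w t z w' u' ≤ B κ a a' u w w' u'`).

## What this module provides (additive; `NobleBlocks.lean` / `NobleBlocksNT.lean` untouched)

* `blockBNTpt₀ L ι a b v x y t z` — the App. B table of `B^{(2),ι,a,b}(0,v,x,y)` with its two internal vertices
  `(u,w) ↦ (t,z)` EXPOSED (the printed summand, verbatim, row by row), and
  `tsum_tsum_blockBNTpt₀ : Σ_{t,z} blockBNTpt₀ … t z = blockBNT₀ …`;
* `blockBNTpt L κ a a' u w t z w' u'` — the same at a general base point, in the slot order of the chain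
  (entry pair `(u,w)`, internal pair `(t,z)`, exit pair `(w',u')`), with `tsum_tsum_blockBNTpt : Σ_{t,z} … = blockBNT L κ a a' u w w' u'`;
* `blockBpt L B2pt κ a a' u w t z w' u'` — (5.4) pointwise: `Σ_c A^{κ,a,c,*}(u,w,t,z) A^{c,a'}(t,z,w',u')
  + δ_{z,t} A^{κ,a,a'}(u,w,w',t) P^{0}(u'−t,u'−t) + B2pt(…)` (CONVENTIONS: in the first term the internal pair is the
  printed `(u,w)` of (5.4) in this order; in the second term, which has ONE internal vertex, the second internal
  coordinate is pinned to the first by `δ_{z,t}` — a cover that defines its canonical `z_i` differently on such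
  configurations uses a re-pinned variant with the same sum; the third term is the parameter), with
  `tsum_tsum_blockBpt : Σ_{t,z} blockBpt L B2pt … = blockB L B2 …` whenever `Σ_{t,z} B2pt = B2`;
* `blockBFullpt L := blockBpt L (blockBNTpt L)` and **`tsum_tsum_blockBFullpt : Σ_{t,z} blockBFullpt L κ a a' u w t z w' u'
  = blockBFull L κ a a' u w w' u'`**, whence `blockBFullpt_hBpt` = the hypothesis `hBpt` of the regrouping at
  `B := blockBFull L` (with equality).

Pure `[0,∞]` algebra over the `Letters` interface (every `d`, every letter table); no percolation estimate is
proved here and nothing is cited as a fact.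
-/

noncomputable section

namespace Literature.Probability.FitznerVanDerHofstad2017.NobleBlocks

open Literature.Probability.LatticeModels Literature.Probability.Percolation
open Literature.Probability.FitznerVanDerHofstad2017.BlockSummation
open scoped BigOperators ENNReal

variable {d : ℕ}

/-! ### 0. Two Kronecker summations -/

/-- `Σ_z δ_{z,t} c = c`. [folklore] -/
theorem tsum_kd_mul_const (t : Site d) (c : ℝ≥0∞) : ∑' z, kd z t * c = c := by
  rw [tsum_eq_single t fun z hz => by simp [kd_of_ne hz]]
  simp

/-- `Σ_z δ_{z,t} F(z) = F(t)`. [folklore] -/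
theorem tsum_kd_mul_apply (t : Site d) (F : Site d → ℝ≥0∞) : ∑' z, kd z t * F z = F t := by
  rw [tsum_eq_single t fun z hz => by simp [kd_of_ne hz]]
  simp

/-! ### A. `B^{(2),ι,a,b}(0,v,x,y)` with the internal vertices exposed -/

/-- **The summand of `B^{(2),ι,a,b}(0,v,x,y)`** (App. B Table, v2 p. 76, TeX l.10515–10539) as a function of the
two internal vertices, printed `(u,w)`, here `(t,z)`: row by row the expression under `Σ_{u,w}` of
`NobleBlocks.blockBNT₀` (zero rows `b = 0, 1`, l.10592).
[cite: FitznerVanDerHofstad2017, App. B Table "Diagrams and definition of B^{(2),ι,a,b}(0,v,x,y)" (arXiv:1506.07977v2 p. 76)] -/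
def blockBNTpt₀ (L : Letters d) (ι : Fin d × Bool) (a b : Fin 3) (v x y t z : Site d) : ℝ≥0∞ :=
  let e : Site d := stepVec ι
  match a.val, b.val with
  | _, 0 => 0
  | _, 1 => 0
  | 0, _ => kd v 0 * (kdc v z *
            (twoDD (z - t) * L.S (.ge 1) (.eq 1) (.ge 1) (.ge 0) z t x e * L.T (.ge 1) (.ge 1) (.eq 1) (t - y) (z - y) 0
              + L.S (.ge 1) (.ge 0) (.eq 1) (.ge 1) (x - t) (e - t) (-t) (z - t) *
                L.T (.ge 2) (.ge 1) (.ge 1) (z - t) (y - t) 0))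
  | 1, _ => L.p⁻¹ * twoDD v * twoDD (z - t) * L.T (.ge 1) (.ge 1) (.eq 1) (y - t) (z - t) 0 *
                L.P (.eq 1) (.ge 0) (.ge 1) (.eq 1) (.ge 0) e x t z v
              + L.p⁻¹ * L.T (.ge 1) (.ge 1) (.ge 2) (y - t) (z - t) 0 *
                L.P (.ge 1) (.ge 0) (.eq 1) (.eq 1) (.ge 0) (x - t) (e - t) (-t) (v - t) (z - t)
  | _, _ => L.p⁻¹ * twoDD (z - t) * L.T (.ge 1) (.ge 1) (.eq 1) (t - y) (z - y) 0 *
                L.P (.eq 1) (.ge 0) (.ge 1) (.eq 1) (.ge 0) e x t z v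
              + L.B (.ge 1) (.ge 1) (t - y) (z - y) * L.P (.eq 1) (.ge 0) (.ge 1) (.ge 2) (.ge 0) e x t z v

/-- **Summing the exposed internal pair gives back the table entry**: `Σ_{t,z} blockBNTpt₀ … t z = B^{(2),ι,a,b}(0,v,x,y)`.
[cite: FitznerVanDerHofstad2017, App. B Table "Diagrams and definition of B^{(2),ι,a,b}(0,v,x,y)" (arXiv:1506.07977v2 p. 76)] -/
theorem tsum_tsum_blockBNTpt₀ (L : Letters d) (ι : Fin d × Bool) (a b : Fin 3) (v x y : Site d) :
    ∑' t, ∑' z, blockBNTpt₀ L ι a b v x y t z = blockBNT₀ L ι a b v x y := by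
  rcases a with ⟨_ | _ | _ | n, ha⟩ <;> rcases b with ⟨_ | _ | _ | m, hb⟩ <;>
    first
    | (exfalso; omega)
    | (simp only [blockBNTpt₀, blockBNT₀, tsum_zero, ENNReal.tsum_mul_left])

/-- **`B^{(2)}` pointwise at a general base point, in the chain's slot order**: entry pair `(u,w)`, internal pair
`(t,z)`, exit pair `(w',u')`; `= blockBNTpt₀ L κ a a' (w−u) (w'−u) (u'−u) (t−u) (z−u)` (translation by the base
point, as `NobleBlocks.ofBase`). [cite: FitznerVanDerHofstad2017, App. B Table "B^{(2),ι,a,b}(0,v,x,y)" (arXiv:1506.07977v2 p. 76); §5.1 (5.4) (p. 48)] -/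
def blockBNTpt (L : Letters d) (κ : Fin d × Bool) (a a' : Fin 3) (u w t z w' u' : Site d) : ℝ≥0∞ :=
  blockBNTpt₀ L κ a a' (w - u) (w' - u) (u' - u) (t - u) (z - u)

/-- `Σ_{t,z} blockBNTpt L κ a a' u w t z w' u' = B^{(2),κ,a,a'}(u,w,w',u')` (`= blockBNT L κ a a' u w w' u'`).
[cite: FitznerVanDerHofstad2017, App. B Table "B^{(2),ι,a,b}(0,v,x,y)" (arXiv:1506.07977v2 p. 76)] -/
theorem tsum_tsum_blockBNTpt (L : Letters d) (κ : Fin d × Bool) (a a' : Fin 3) (u w w' u' : Site d) :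
    ∑' t, ∑' z, blockBNTpt L κ a a' u w t z w' u' = blockBNT L κ a a' u w w' u' := by
  unfold blockBNTpt
  have h : ∀ t, ∑' z, blockBNTpt₀ L κ a a' (w - u) (w' - u) (u' - u) (t - u) (z - u)
      = ∑' z, blockBNTpt₀ L κ a a' (w - u) (w' - u) (u' - u) (t - u) z := fun t =>
    tsum_sub_right_eq (fun z => blockBNTpt₀ L κ a a' (w - u) (w' - u) (u' - u) (t - u) z) u
  simp_rw [h]
  rw [tsum_sub_right_eq (fun t => ∑' z, blockBNTpt₀ L κ a a' (w - u) (w' - u) (u' - u) t z) u,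
    tsum_tsum_blockBNTpt₀]
  rfl

/-! ### B. (5.4) pointwise -/

/-- The type of a middle-block family POINTWISE in its internal pair: direction, entry class, exit class, entry
pair `(u,w)`, internal pair `(t,z)`, exit pair `(w',u')` (the `Bpt` slot order of `BlockSummation.chainTail`).
[cite: FitznerVanDerHofstad2017, §5.1 (5.4) (arXiv:1506.07977v2 p. 48); §6.2.1 (6.48)–(6.51) (pp. 65–67)] -/
abbrev DirBlockFamilyPt (d : ℕ) : Type :=
  Fin d × Bool → Fin 3 → Fin 3 → Site d → Site d → Site d → Site d → Site d → Site d → ℝ≥0∞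

/-- **(5.4) pointwise in the internal pair `(t,z)`**:
`Σ_c A^{κ,a,c,*}(u,w,t,z) A^{c,a'}(t,z,w',u') + δ_{z,t} A^{κ,a,a'}(u,w,w',t) P^{0}(u'−t,u'−t) + B2pt^{κ,a,a'}(u,w,t,z,w',u')`.
CONVENTIONS: first term — the internal pair is the printed `(u,w)` of (5.4), in this order; second term — one
internal vertex (printed `u`, here `t`), the second internal coordinate pinned by `δ_{z,t}`; third term — the
parameter `B2pt` (e.g. `blockBNTpt L`).
[cite: FitznerVanDerHofstad2017, §5.1 (5.4) (arXiv:1506.07977v2 p. 48)] -/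
def blockBpt (L : Letters d) (B2pt : DirBlockFamilyPt d) : DirBlockFamilyPt d :=
  fun κ a a' u w t z w' u' =>
    (∑ c : Fin 3, blockAiotaSt L κ a c u w t z * blockA L c a' t z w' u')
      + kd z t * (blockAiota L κ a a' u w w' t * blockPS L 0 (u' - t) (u' - t))
      + B2pt κ a a' u w t z w' u'

/-- **Summing the internal pair of the pointwise (5.4) gives (5.4)**: if `Σ_{t,z} B2pt = B2` then
`Σ_{t,z} blockBpt L B2pt κ a a' u w t z w' u' = blockB L B2 κ a a' u w w' u'`.
[cite: FitznerVanDerHofstad2017, §5.1 (5.4) (arXiv:1506.07977v2 p. 48)] -/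
theorem tsum_tsum_blockBpt (L : Letters d) (B2pt : DirBlockFamilyPt d) (B2 : DirBlockFamily d)
    (hB2 : ∀ κ a a' u w w' u', ∑' t, ∑' z, B2pt κ a a' u w t z w' u' = B2 κ a a' u w w' u')
    (κ : Fin d × Bool) (a a' : Fin 3) (u w w' u' : Site d) :
    ∑' t, ∑' z, blockBpt L B2pt κ a a' u w t z w' u' = blockB L B2 κ a a' u w w' u' := by
  simp only [blockBpt, blockB, comp, ENNReal.tsum_add, hB2]
  congr 2
  · simp_rw [tsum_finsetSum]
  · refine tsum_congr fun t => ?_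
    exact tsum_kd_mul_const t _

/-- **`B^{ι,a,b}` of (5.4) with the typed right piece, pointwise**: `blockBpt L (blockBNTpt L)`.
[cite: FitznerVanDerHofstad2017, §5.1 (5.4) (arXiv:1506.07977v2 p. 48); App. B (p. 76)] -/
def blockBFullpt (L : Letters d) : DirBlockFamilyPt d := blockBpt L (blockBNTpt L)

/-- **`Σ_{t,z} blockBFullpt L κ a a' u w t z w' u' = blockBFull L κ a a' u w w' u'`** ((5.4) = the internal-pair
sum of its pointwise version). [cite: FitznerVanDerHofstad2017, §5.1 (5.4) (arXiv:1506.07977v2 p. 48); App. B (p. 76)] -/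
theorem tsum_tsum_blockBFullpt (L : Letters d) (κ : Fin d × Bool) (a a' : Fin 3) (u w w' u' : Site d) :
    ∑' t, ∑' z, blockBFullpt L κ a a' u w t z w' u' = blockBFull L κ a a' u w w' u' :=
  tsum_tsum_blockBpt L (blockBNTpt L) (blockBNT L) (tsum_tsum_blockBNTpt L) κ a a' u w w' u'

/-- **The block-summation hypothesis `hBpt` of `BlockSummation.le_recP_chain_of_pointwise` /
`nobleXiT_le_recP_chain_of_cls` at `B := blockBFull L`, `Bpt := blockBFullpt L`** (with equality).
[cite: FitznerVanDerHofstad2017, §5.1 (5.4) (arXiv:1506.07977v2 p. 48); §6.2.1 (6.49)–(6.51) (pp. 65–67)] -/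
theorem blockBFullpt_hBpt (L : Letters d) :
    ∀ κ a a' (u w w' u' : Site d), ∑' t, ∑' z, blockBFullpt L κ a a' u w t z w' u' ≤ blockBFull L κ a a' u w w' u' :=
  fun κ a a' u w w' u' => (tsum_tsum_blockBFullpt L κ a a' u w w' u').le

end Literature.Probability.FitznerVanDerHofstad2017.NobleBlocks

end
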